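import Summits.HubbardSuperconductivity.HubbardSuperconductivity.Theorems.InfiniteVolumeFirstNoNormalLimitStateStubWindowFloorAtom

/-!
# Crux `NoNormalLimitState` (stmt-HubbardSuperconductivity-18533, route `InfiniteVolumeFirst`) —
# the Portmanteau direction: even-side pair LRO forces the atom; cofinal LRO ⇒ the crux

Corollaries of the window-floor stub `NoNormalLimitState.stub_windowFloorAtom` (line
`window-gap-transfer`), formalising kill criterion (iv) of the route thesis:

* `windowSum_ge_of_lro` — at a fixed side the zero mode lies in every window, so the window pair
  weight dominates the zero-momentum order: `L² · LRO_L ≤ Σ_{|q_m| ≤ ε} S_L(m)` (`ε ≥ 0`), where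
  `LRO_L = |Λ_L|⁻² Σ_{x,y ∈ Λ_L} G_L(x,y) = L⁻⁴ ‖Δ_d ψ_L‖²` and `S_L(0) = L⁻² ‖Δ_d ψ_L‖²`.
* `atom_pos_of_hasLongRangeOrder` — for a family normalised at even sides, `d`-wave pair LRO along
  the even sides in the summit's format (`0 < liminf_k LRO_{2k}`) gives window floors at every scale,
  hence (stub) a positive condensate atom `liminf_R R⁻⁴ Σ_{x,y∈[0,R)²} C(x−y) ≥ ½ liminf_k LRO_{2k} > 0`
  of EVERY pointwise torus limit `C` — the conclusion of the crux for this family. This is the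
  converse of the route's exchange lemma `TightnessExchange` and needs no tightness.
* `stub_cofinalLroTransfer` — hence `NoNormalLimitState` follows from the summit's every-ground-state
  LRO clause holding at ONE doping for couplings accumulating at `0⁺`: a constructive proof of the
  summit at arbitrarily weak coupling closes the crux (kill criterion (iv)); with the route's
  assembly (`crux ∧ NoInfraredPileUp ⇒ summit`) the crux is sandwiched between summit-type statements.

Sources: Kennedy–Lieb–Shastry, PRL **61** (1988) 2582; Friedli–Velenik (2017) §3.7.2, §10.4;
Billingsley, *Convergence of Probability Measures*, Thm 2.1 (Portmanteau, closed sets) — here in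
elementary finite-sum form. No definition and no named fact is introduced.
-/

noncomputable section

-- the mandated namespace `Summit.<Summit>.<Problem>.Theorems` repeats `HubbardSuperconductivity`
-- (single-problem summit, D-0017), which the `dupNamespace` linter flags on every declaration
set_option linter.dupNamespace false

namespace Summit.HubbardSuperconductivity.HubbardSuperconductivity.Theorems.NoNormalLimitState

open Literature.MathematicalPhysics.QuantumLattice Literature.Probability.LatticeModels Matrix Finset
  Filter
open scoped ComplexConjugate ComplexOrder Topology

/-- **The window dominates the zero mode.** At side `L = n + 1`, for every `ε ≥ 0` and every
family `ψ` (any real `ε`): `L² · LRO_L ≤ Σ_{|q_m|² ≤ ε²} S_L(m)` — the zero momentum lies in the window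
(`momentumNormSq_zero`), the modes are nonnegative (`pairStructureFactor_nonneg`), and
`S_L(0) = L⁻² Re⟨ψ_L, Δ_dᴴ Δ_d ψ_L⟩ = L² · LRO_L` (`pairStructureFactor_zero`,
`torusLROSeq_pairFieldCorr_succ`). Scalapino, Phys. Rep. 250 (1995) 329, §2. [folklore] -/
theorem windowSum_ge_of_lro (ψ : ∀ L, Fock (Orb (FermionTorus 2 L))) (n : ℕ) (ε : ℝ) :
    ((n + 1 : ℕ) : ℝ) ^ 2 * ((∑ x ∈ halfOpenBox 2 (n + 1), ∑ y ∈ halfOpenBox 2 (n + 1),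
        torusPullback (pairFieldCorr dWaveFormFactor ψ) (n + 1) x y) /
          ((halfOpenBox 2 (n + 1)).card : ℝ) ^ 2) ≤
      ∑ m : TorusSite 2 (n + 1), if momentumNormSq (n + 1) m ≤ ε ^ 2 then
        pairStructureFactor dWaveFormFactor (n + 1) (ψ (n + 1)) m else 0 := by
  classical
  have hLpos : (0 : ℝ) < ((n + 1 : ℕ) : ℝ) := Nat.cast_pos.2 (Nat.succ_pos n)
  rw [torusLROSeq_pairFieldCorr_succ]
  have h0 : ((n + 1 : ℕ) : ℝ) ^ 2 * ((expect ((pairField dWaveFormFactor (n + 1))ᴴ *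
      pairField dWaveFormFactor (n + 1)) (ψ (n + 1))).re / ((n + 1 : ℕ) : ℝ) ^ 4) =
      pairStructureFactor dWaveFormFactor (n + 1) (ψ (n + 1)) 0 := by
    rw [pairStructureFactor_zero]
    field_simp
  rw [h0]
  have hmem : momentumNormSq (n + 1) (0 : TorusSite 2 (n + 1)) ≤ ε ^ 2 := by
    rw [momentumNormSq_zero]; positivity
  calc pairStructureFactor dWaveFormFactor (n + 1) (ψ (n + 1)) 0
      = (if momentumNormSq (n + 1) (0 : TorusSite 2 (n + 1)) ≤ ε ^ 2 then
          pairStructureFactor dWaveFormFactor (n + 1) (ψ (n + 1)) 0 else 0) := by rw [if_pos hmem]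
    _ ≤ ∑ m : TorusSite 2 (n + 1), if momentumNormSq (n + 1) m ≤ ε ^ 2 then
          pairStructureFactor dWaveFormFactor (n + 1) (ψ (n + 1)) m else 0 :=
        Finset.single_le_sum (f := fun m => if momentumNormSq (n + 1) m ≤ ε ^ 2 then
            pairStructureFactor dWaveFormFactor (n + 1) (ψ (n + 1)) m else 0)
          (fun m _ => by
            split_ifs
            · exact pairStructureFactor_nonneg _ _ _ _
            · exact le_rfl)
          (Finset.mem_univ 0)

/-- **Even-side pair LRO ⇒ positive condensate atom of every torus limit.** For a family `ψ`
normalised at even sides with `d`-wave pair-field long-range order along the even sides in the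
summit's format (`0 < liminf_k |Λ_{2k}|⁻² ⟨ψ_{2k}, Δ_d† Δ_d ψ_{2k}⟩`), every pointwise limit `C` of the
translation-averaged pair correlations along a strictly increasing sequence of even sides has
`0 < liminf_R R⁻⁴ Σ_{x,y ∈ [0,R)²} C(x − y)` — the crux's conclusion for this family (converse of
`TightnessExchange`; unconditional). Proof: eventually `LRO_{2k} > a/2`, `a` the liminf; by
`windowSum_ge_of_lro` this is a window floor `(a/2) L² ≤ Σ_{|q_m|≤ε} S_L(m)` at every scale `ε`, and
`stub_windowFloorAtom` gives the atom `≥ a/2`. Kennedy–Lieb–Shastry, PRL 61 (1988) 2582. [folklore] -/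
theorem atom_pos_of_hasLongRangeOrder
    (ψ : ∀ L, Fock (Orb (FermionTorus 2 L))) (hnorm : ∀ L, Even L → star (ψ L) ⬝ᵥ ψ L = 1)
    (hLRO : HasLongRangeOrder (fun k => halfOpenBox 2 (2 * k))
      (fun k => torusPullback (pairFieldCorr dWaveFormFactor ψ) (2 * k)))
    (Ls : ℕ → ℕ) (C : Site 2 → ℝ) (hLs : StrictMono Ls) (hLs_even : ∀ j, Even (Ls j))
    (hconv : ∀ x : Site 2, Tendsto (fun j : ℕ => (∑ y ∈ halfOpenBox 2 (Ls j),
      torusPullback (pairFieldCorr dWaveFormFactor ψ) (Ls j) (x + y) y) / ((Ls j : ℕ) : ℝ) ^ 2)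
      atTop (𝓝 (C x))) :
    0 < liminf (fun R : ℕ => (∑ x ∈ halfOpenBox 2 R, ∑ y ∈ halfOpenBox 2 R, C (x - y)) /
      ((R : ℕ) : ℝ) ^ 4) atTop := by
  -- the long-range-order sequence
  obtain ⟨u, hu⟩ : ∃ u : ℕ → ℝ, ∀ L, u L = (∑ x ∈ halfOpenBox 2 L, ∑ y ∈ halfOpenBox 2 L,
      torusPullback (pairFieldCorr dWaveFormFactor ψ) L x y) / ((halfOpenBox 2 L).card : ℝ) ^ 2 :=
    ⟨_, fun _ => rfl⟩
  have hliminf : 0 < liminf (fun k => u (2 * k)) atTop := by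
    simpa only [HasLongRangeOrder, hu] using hLRO
  have hu0 : ∀ k, 0 ≤ u (2 * k) := fun k => by
    rw [hu]; exact tightnessExchange_lroSeq_nonneg ψ _
  set a : ℝ := liminf (fun k => u (2 * k)) atTop with ha_def
  have ha2 : a / 2 < a := by linarith
  have hevk : ∀ᶠ k in atTop, a / 2 < u (2 * k) :=
    eventually_lt_of_lt_liminf ha2 (isBoundedUnder_of ⟨0, fun k => hu0 k⟩)
  obtain ⟨K, hK⟩ := eventually_atTop.1 hevk
  -- window floors at every scale, at all even sides `L ≥ 2K`
  have hfloor : ∀ ε : ℝ, 0 < ε → ∃ L₀ : ℕ, ∀ (L : ℕ) [NeZero L], Even L → L₀ ≤ L →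
      a / 2 * (L : ℝ) ^ 2 ≤ ∑ m : TorusSite 2 L,
        if momentumNormSq L m ≤ ε ^ 2 then pairStructureFactor dWaveFormFactor L (ψ L) m else 0 := by
    intro ε _
    refine ⟨2 * K, fun L _ hLe hLge => ?_⟩
    obtain ⟨n, hn⟩ : ∃ n, L = n + 1 := ⟨L - 1, by have := NeZero.ne L; omega⟩
    have h2 : 2 * (L / 2) = L := Nat.two_mul_div_two_of_even hLe
    have hk : K ≤ L / 2 := by omega
    have hlro : a / 2 < u L := by have h := hK (L / 2) hk; rwa [h2] at h
    subst hn
    have hw := windowSum_ge_of_lro ψ n ε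
    rw [← hu] at hw
    have : a / 2 * ((n + 1 : ℕ) : ℝ) ^ 2 ≤ ((n + 1 : ℕ) : ℝ) ^ 2 * u (n + 1) := by
      rw [mul_comm]
      exact mul_le_mul_of_nonneg_left hlro.le (by positivity)
    exact this.trans hw
  have hatom := stub_windowFloorAtom ψ (a / 2) (by positivity) hnorm hfloor Ls C hLs hLs_even hconv
  exact lt_of_lt_of_le (by positivity) hatom

/-- **Cofinal every-ground-state LRO implies `NoNormalLimitState`** (kill criterion (iv) of the
route thesis). If at some hole doping `δ ∈ (0, 1/2)` the summit's conclusion — `d`-wave pair-field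
long-range order along even sides for EVERY admissible family of sector ground states of
`hubbardTorus 2 L 1 U` — holds for couplings `U` accumulating at `0⁺` (for every `U₀ > 0` some
`U ∈ (0, U₀)`), then the crux `NoNormalLimitState` holds (`atom_pos_of_hasLongRangeOrder`).
Conversely the route's assembly needs the crux AND `NoInfraredPileUp`; the single-`U` summit does
not give the crux (it fixes one `U`). Scalapino, Phys. Rep. 250 (1995) 329, §2;
Kennedy–Lieb–Shastry, PRL 61 (1988) 2582. [folklore] -/
theorem stub_cofinalLroTransfer :
    (∃ δ ∈ Set.Ioo (0:ℝ) (1 / 2), ∀ U₀ : ℝ, 0 < U₀ → ∃ U ∈ Set.Ioo (0:ℝ) U₀,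
      ∀ (N : ℕ → ℕ) (ψ : ∀ L, Fock (Orb (FermionTorus 2 L))),
        (∀ L, Even L → N L = 2 * ⌊(1 - δ) * (L : ℝ) ^ 2 / 2⌋₊ ∧ star (ψ L) ⬝ᵥ ψ L = 1 ∧
          IsGroundStateInSector (hubbardTorus 2 L 1 U) (N L) 0 (ψ L)) →
        HasLongRangeOrder (fun k => halfOpenBox 2 (2 * k))
          (fun k => torusPullback (pairFieldCorr dWaveFormFactor ψ) (2 * k))) →
    Summit.HubbardSuperconductivity.HubbardSuperconductivity.Theses.InfiniteVolumeFirst.NoNormalLimitState := by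
  rintro ⟨δ, hδ, hU⟩
  refine ⟨δ, hδ, fun U₀ hU₀ => ?_⟩
  obtain ⟨U, hUmem, hall⟩ := hU U₀ hU₀
  refine ⟨U, hUmem, fun N ψ hadm Ls C hLs hLs_even hconv => ?_⟩
  exact atom_pos_of_hasLongRangeOrder ψ (fun L hL => (hadm L hL).2.1) (hall N ψ hadm) Ls C hLs
    hLs_even hconv

/-! ### Necessity of the window floors (per family): atoms of all limits ⇒ floors at every scale -/

/-- **Atoms of every limit force window floors at every scale (the interface of the line is lossless
per family).** For a family `ψ` normalised at even sides: if EVERY pointwise limit `C` of the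
translation-averaged `d`-wave pair correlations along a strictly increasing sequence of even sides
has `liminf_R R⁻⁴ Σ_{x,y∈[0,R)²} C(x − y) ≥ a`, then for every window radius `ε > 0` and every
`a' < a` the window pair weight satisfies `Σ_{|q_m| ≤ ε} S_{ψ_L}(m) ≥ a' L²` at all large even `L`.
Together with `stub_windowFloorAtom` (floors ⇒ atoms): for a fixed family, "window floors `a'` at
every scale for all `a' < a`" and "every limit has atom `≥ a`" are EQUIVALENT data — the UPPER Fejér
bound `R⁻⁴ Σ_{x,y∈[0,R)²} C_L(x−y) ≤ L⁻² Σ_{|q_m|≤ε} S_L(m) + 2π²C_d²/(R²ε²)`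
(`tightnessExchange_fejer_bound`) needs no tightness when the window keeps its zero mode. Proof: if
the floor `a'` fails at scale `ε` along infinitely many even sides, extract them
(`extraction_of_frequently_atTop`), pass to a pointwise convergent subsequence (`|C_L| ≤ C_d²`,
`IsCompact.tendsto_subseq`), and let `j → ∞` then `R → ∞` in the upper bound: the limit has atom
`≤ a' < a`. Kennedy–Lieb–Shastry, PRL 61 (1988) 2582; Friedli–Velenik (2017) §10.4. [folklore] -/
theorem stub_windowFloorOfAtom :
    ∀ (ψ : ∀ L, Fock (Orb (FermionTorus 2 L))) (a : ℝ),
      (∀ L, Even L → star (ψ L) ⬝ᵥ ψ L = 1) →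
      (∀ (Ls : ℕ → ℕ) (C : Site 2 → ℝ), StrictMono Ls → (∀ j, Even (Ls j)) →
        (∀ x : Site 2, Tendsto (fun j : ℕ => (∑ y ∈ halfOpenBox 2 (Ls j),
          torusPullback (pairFieldCorr dWaveFormFactor ψ) (Ls j) (x + y) y) / ((Ls j : ℕ) : ℝ) ^ 2)
          atTop (𝓝 (C x))) →
        a ≤ liminf (fun R : ℕ => (∑ x ∈ halfOpenBox 2 R, ∑ y ∈ halfOpenBox 2 R, C (x - y)) /
          ((R : ℕ) : ℝ) ^ 4) atTop) →
      ∀ (ε : ℝ), 0 < ε → ∀ (a' : ℝ), a' < a →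
        ∃ L₀ : ℕ, ∀ (L : ℕ) [NeZero L], Even L → L₀ ≤ L →
          a' * (L : ℝ) ^ 2 ≤ ∑ m : TorusSite 2 L,
            if momentumNormSq L m ≤ ε ^ 2 then
              pairStructureFactor dWaveFormFactor L (ψ L) m else 0 := by
  intro ψ a hnorm hatom ε hε a' ha'
  classical
  by_contra hneg
  push Not at hneg
  -- the constant `C_d²`
  obtain ⟨B, hB⟩ : ∃ B : ℝ, B = (∑ e ∈ insert (0 : Site 2) unitSteps,
      ‖((dWaveFormFactor e / Real.sqrt 2 : ℝ) : ℂ)‖ * 2) ^ 2 := ⟨_, rfl⟩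
  have hB0 : 0 ≤ B := by rw [hB]; positivity
  -- the window pair weight at side `n + 1` and the translation-averaged correlations
  obtain ⟨W, hW⟩ : ∃ W : ℕ → ℝ, ∀ n, W n = ∑ m : TorusSite 2 (n + 1),
      if momentumNormSq (n + 1) m ≤ ε ^ 2 then
        pairStructureFactor dWaveFormFactor (n + 1) (ψ (n + 1)) m else 0 := ⟨_, fun _ => rfl⟩
  obtain ⟨Cavg, hCavg⟩ : ∃ Cavg : ℕ → Site 2 → ℝ, ∀ L x, Cavg L x =
      (∑ y ∈ halfOpenBox 2 L, torusPullback (pairFieldCorr dWaveFormFactor ψ) L (x + y) y) /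
        ((L : ℕ) : ℝ) ^ 2 := ⟨_, fun _ _ => rfl⟩
  -- Step 1: infinitely many even sides `n + 1` violate the floor
  have hfreq : ∃ᶠ n in atTop, Even (n + 1) ∧ W n < a' * ((n + 1 : ℕ) : ℝ) ^ 2 := by
    rw [frequently_atTop]
    intro n₀
    obtain ⟨L, hL, hLe, hLge, hlt⟩ := hneg (n₀ + 1)
    obtain ⟨n, rfl⟩ : ∃ n, L = n + 1 := ⟨L - 1, by have := hL.ne; omega⟩
    refine ⟨n, by omega, hLe, ?_⟩
    rw [hW]
    exact hlt
  obtain ⟨φ₁, hφ₁, hφ₁P⟩ := extraction_of_frequently_atTop hfreq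
  -- Step 2: a pointwise convergent further subsequence (diagonal argument)
  obtain ⟨K, hK⟩ : ∃ K : Set (Site 2 → ℝ), K = Set.pi Set.univ fun _ => Set.Icc (-B) B :=
    ⟨_, rfl⟩
  have hKc : IsCompact K := hK ▸ isCompact_univ_pi fun _ => isCompact_Icc
  have hmem : ∀ j, (fun x => Cavg (φ₁ j + 1) x) ∈ K := fun j =>
    hK ▸ Set.mem_univ_pi.2 fun x => abs_le.1 (by
      rw [hCavg, hB]
      exact tightnessExchange_abs_corrAvg_le ψ _ (hnorm _ (hφ₁P j).1) x)
  obtain ⟨C, -, φ₂, hφ₂, hconv⟩ := hKc.tendsto_subseq hmem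
  obtain ⟨Ls, hLs⟩ : ∃ Ls : ℕ → ℕ, ∀ j, Ls j = φ₁ (φ₂ j) + 1 := ⟨_, fun _ => rfl⟩
  have hLs_mono : StrictMono Ls := fun i j hij => by
    rw [hLs, hLs]
    exact Nat.succ_lt_succ (hφ₁ (hφ₂ hij))
  have hLs_even : ∀ j, Even (Ls j) := fun j => hLs j ▸ (hφ₁P _).1
  have hLs_lt : ∀ j, W (φ₁ (φ₂ j)) < a' * ((φ₁ (φ₂ j) + 1 : ℕ) : ℝ) ^ 2 := fun j => (hφ₁P _).2
  have hLs_conv : ∀ x : Site 2, Tendsto (fun j => Cavg (Ls j) x) atTop (𝓝 (C x)) := fun x =>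
    (tendsto_pi_nhds.1 hconv x).congr fun j => by simp only [Function.comp_apply, hLs]
  -- Step 3: the atom of this limit is at least `a`
  obtain ⟨b, hb⟩ : ∃ b : ℕ → ℝ, ∀ R, b R = (∑ x ∈ halfOpenBox 2 R, ∑ y ∈ halfOpenBox 2 R,
      C (x - y)) / ((R : ℕ) : ℝ) ^ 4 := ⟨_, fun _ => rfl⟩
  have hatomC : a ≤ liminf b atTop := by
    have h := hatom Ls C hLs_mono hLs_even (fun x => by simpa only [hCavg] using hLs_conv x)
    have hfun : (fun R : ℕ => (∑ x ∈ halfOpenBox 2 R, ∑ y ∈ halfOpenBox 2 R, C (x - y)) /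
        ((R : ℕ) : ℝ) ^ 4) = b := funext fun R => (hb R).symm
    rwa [hfun] at h
  -- `b` is bounded below (by `-B`), so its liminf is honest
  have hCbd : ∀ x, |C x| ≤ B := fun x => by
    refine le_of_tendsto ((continuous_abs.tendsto _).comp (hLs_conv x)) ?_
    filter_upwards [Filter.eventually_ge_atTop 0] with j _
    simp only [Function.comp_apply, hCavg, hB]
    exact tightnessExchange_abs_corrAvg_le ψ _ (hnorm _ (hLs_even j)) x
  have hb_low : ∀ R, -B ≤ b R := by
    intro R
    have habs : |b R| ≤ B := by
      rw [hb, abs_div, abs_of_nonneg (by positivity : (0 : ℝ) ≤ ((R : ℕ) : ℝ) ^ 4)]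
      rcases Nat.eq_zero_or_pos R with rfl | hRpos
      · simpa using hB0
      · rw [div_le_iff₀ (by positivity)]
        calc |∑ x ∈ halfOpenBox 2 R, ∑ y ∈ halfOpenBox 2 R, C (x - y)|
            ≤ ∑ x ∈ halfOpenBox 2 R, |∑ y ∈ halfOpenBox 2 R, C (x - y)| :=
              Finset.abs_sum_le_sum_abs _ _
          _ ≤ ∑ x ∈ halfOpenBox 2 R, ∑ y ∈ halfOpenBox 2 R, |C (x - y)| :=
              Finset.sum_le_sum fun x _ => Finset.abs_sum_le_sum_abs _ _
          _ ≤ ∑ x ∈ halfOpenBox 2 R, ∑ y ∈ halfOpenBox 2 R, B :=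
              Finset.sum_le_sum fun x _ => Finset.sum_le_sum fun y _ => hCbd _
          _ = B * ((R : ℕ) : ℝ) ^ 4 := by
              rw [Finset.sum_const, Finset.sum_const, card_halfOpenBox, smul_smul, nsmul_eq_mul]
              push_cast
              ring
    exact (abs_le.1 habs).1
  -- Step 4: the upper Fejér bound in the limit: `b R ≤ a' + 2π²B/(R²ε²)` for every `R > 0`
  have hR : ∀ R : ℕ, 0 < R → b R ≤ a' + 2 * Real.pi ^ 2 * B / ((R : ℝ) ^ 2 * ε ^ 2) := by
    intro R hRpos
    have hbj : Tendsto (fun j => (∑ x ∈ halfOpenBox 2 R, ∑ y ∈ halfOpenBox 2 R,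
        Cavg (Ls j) (x - y)) / ((R : ℕ) : ℝ) ^ 4) atTop (𝓝 (b R)) := by
      rw [hb]
      exact (tendsto_finsetSum _ fun x _ => tendsto_finsetSum _ fun y _ =>
        hLs_conv (x - y)).div_const _
    refine le_of_tendsto hbj (Filter.Eventually.of_forall fun j => ?_)
    set n := φ₁ (φ₂ j) with hn_def
    have hn : Ls j = n + 1 := hLs j
    have hevn : Even (n + 1) := hn ▸ hLs_even j
    have hψn : star (ψ (n + 1)) ⬝ᵥ ψ (n + 1) = 1 := hnorm (n + 1) hevn
    have hf := tightnessExchange_fejer_bound ψ n hψn R hRpos ε hε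
    rw [← hB] at hf
    -- the zero mode plus the punctured window is the full window: `LRO_L + L⁻² Σ_{m≠0} = L⁻² W`
    have hLpos : (0 : ℝ) < ((n + 1 : ℕ) : ℝ) := Nat.cast_pos.2 (Nat.succ_pos n)
    have hsplit : (∑ x ∈ halfOpenBox 2 (n + 1), ∑ y ∈ halfOpenBox 2 (n + 1),
        torusPullback (pairFieldCorr dWaveFormFactor ψ) (n + 1) x y) /
          ((halfOpenBox 2 (n + 1)).card : ℝ) ^ 2 +
        (∑ m : TorusSite 2 (n + 1), if m ≠ 0 ∧ momentumNormSq (n + 1) m ≤ ε ^ 2 then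
          pairStructureFactor dWaveFormFactor (n + 1) (ψ (n + 1)) m else 0) /
          ((n + 1 : ℕ) : ℝ) ^ 2 = W n / ((n + 1 : ℕ) : ℝ) ^ 2 := by
      have h0 : (∑ x ∈ halfOpenBox 2 (n + 1), ∑ y ∈ halfOpenBox 2 (n + 1),
          torusPullback (pairFieldCorr dWaveFormFactor ψ) (n + 1) x y) /
            ((halfOpenBox 2 (n + 1)).card : ℝ) ^ 2 =
          pairStructureFactor dWaveFormFactor (n + 1) (ψ (n + 1)) 0 / ((n + 1 : ℕ) : ℝ) ^ 2 := by
        rw [torusLROSeq_pairFieldCorr_succ, pairStructureFactor_zero]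
        field_simp
      rw [h0, ← add_div, hW]
      congr 1
      rw [Fintype.sum_eq_add_sum_compl (0 : TorusSite 2 (n + 1))
          (fun m => if m ≠ 0 ∧ momentumNormSq (n + 1) m ≤ ε ^ 2 then
            pairStructureFactor dWaveFormFactor (n + 1) (ψ (n + 1)) m else 0),
        Fintype.sum_eq_add_sum_compl (0 : TorusSite 2 (n + 1))
          (fun m => if momentumNormSq (n + 1) m ≤ ε ^ 2 then
            pairStructureFactor dWaveFormFactor (n + 1) (ψ (n + 1)) m else 0)]
      have hz : momentumNormSq (n + 1) (0 : TorusSite 2 (n + 1)) ≤ ε ^ 2 := by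
        rw [momentumNormSq_zero]; positivity
      simp only [ne_eq, not_true_eq_false, false_and, if_false, zero_add, hz, if_true]
      congr 1
      refine Finset.sum_congr rfl fun m hm => ?_
      have hm0 : m ≠ 0 := by simpa using hm
      simp only [hm0, not_false_eq_true, true_and]
    have hWn : W n / ((n + 1 : ℕ) : ℝ) ^ 2 < a' := by
      rw [div_lt_iff₀ (by positivity)]
      exact hLs_lt j
    rw [hn]
    simp only [hCavg]
    linarith
  -- Step 5: hence `liminf b ≤ a' + η` for every `η > 0`, contradicting `a ≤ liminf b`
  have hkey : ∀ η : ℝ, 0 < η → liminf b atTop ≤ a' + η := by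
    intro η hη
    have htail : Tendsto (fun R : ℕ => 2 * Real.pi ^ 2 * B / ((R : ℝ) ^ 2 * ε ^ 2)) atTop
        (𝓝 0) := by
      refine tendsto_const_nhds.div_atTop ?_
      exact ((tendsto_pow_atTop two_ne_zero).comp tendsto_natCast_atTop_atTop).atTop_mul_const
        (pow_pos hε 2)
    have hev : ∀ᶠ R : ℕ in atTop, b R ≤ a' + η := by
      filter_upwards [htail.eventually_le_const hη, eventually_gt_atTop 0] with R h1 h2
      linarith [hR R h2]
    exact liminf_le_of_frequently_le hev.frequently (isBoundedUnder_of ⟨-B, fun R => hb_low R⟩)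
  have h := hkey ((a - a') / 2) (by linarith)
  linarith

end Summit.HubbardSuperconductivity.HubbardSuperconductivity.Theorems.NoNormalLimitState

end
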